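import Mathlib
import Summits.Ventures.HodgeRepro2.T5SmoothDualRep
import Summits.Ventures.HodgeRepro2.T5LevelIdempotentPairing
import Summits.Ventures.HodgeRepro2.T5LevelIdempotentNaturality

/-!
# `π ≅ π̃̃`: a smooth admissible representation is its own double smooth dual

Blind cell `pub-hodge-repro2`, seat p8 (gen 8), Tier-5 kernel support.  With the smooth dual
`π̃ = smoothDualRep ρ` of `T5SmoothDualRep` (T5-59) the classical statement «for a smooth
admissible `π` the canonical map `π → π̃̃` is an isomorphism» (Bernstein–Zelevinsky-type) is recorded
here, for a td-group read as a topological group `G` with a family `𝒦` of compact open subgroups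
that is cofinal among the open subgroups (van Dantzig for the group of the record), `ρ` smooth and
admissible along `𝒦`, characteristic `0`:

* `evalDual ρ v : Module.Dual k (SmoothDualSpace ρ)` — evaluation at `v`; it is `G`-equivariant
  (`evalDual_apply_rep`) and a smooth vector of `π̃.dual` when `ρ` is smooth
  (`evalDual_mem_smoothVectors`);
* `toDoubleDual ρ hρ : V →ₗ[k] SmoothDualSpace (smoothDualRep ρ)` — THE CANONICAL MAP `π → π̃̃`,
  `G`-equivariant (`toDoubleDual_apply_rep`);
* `toDoubleDual_injective` — for smooth `ρ` (the smooth functionals separate the points of `V`: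
  a `K`-fixed vector is detected by a `K`-fixed functional, `T5-42`);
* `toDoubleDual_surjective` — for smooth ADMISSIBLE `ρ`: a smooth functional `Λ` on `π̃` is
  `K`-fixed for some `K ∈ 𝒦`, factors through `e_K`, and on `(π̃)^K ≅ (π^K)^*` is evaluation at some
  `x ∈ π^K` by reflexivity of the finite-dimensional `π^K` (Mathlib's `Module.bijective_dual_eval`);
* `doubleDualEquiv ρ … : V ≃ₗ[k] SmoothDualSpace (smoothDualRep ρ)` — `π ≅ π̃̃`.

README §8(d): uses an L-value-free non-vanishing device: NO.
-/

namespace Summit.Ventures.HodgeRepro2.T5SmoothDoubleDual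

noncomputable section

open Summit.Ventures.HodgeRepro2.LevelPositivity
open Summit.Ventures.HodgeRepro2.T5LevelIdempotent
open Summit.Ventures.HodgeRepro2.T5LevelIdempotentDual
open Summit.Ventures.HodgeRepro2.T5AdmissibleTransfer
open Summit.Ventures.HodgeRepro2.T5SmoothDual
open Summit.Ventures.HodgeRepro2.T5SmoothDualRep
open Summit.Ventures.HodgeRepro2.T5SmoothDualRep.SmoothDualSpace

variable {G : Type*} [Group G] [TopologicalSpace G] [IsTopologicalGroup G]
  {k : Type*} [Field k] {V : Type*} [AddCommGroup V] [Module k V]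

section Stabilizer

variable {ρ : Representation k G V}

/-- A vector with open stabiliser has a finite-index stabiliser in every compact subgroup. -/
theorem finiteIndex_stabilizerIn_of_isOpen_of_isCompact {K : Subgroup G} (hK : IsCompact (K : Set G))
    {v : V} (hv : IsOpen (stabilizer ρ v : Set G)) : (stabilizerIn ρ K v).FiniteIndex := by
  haveI : CompactSpace K := isCompact_iff_compactSpace.mp hK
  have hS : IsOpen ((stabilizerIn ρ K v : Subgroup K) : Set K) := by
    have : ((stabilizerIn ρ K v : Subgroup K) : Set K) =
        Subtype.val ⁻¹' (stabilizer ρ v : Set G) := by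
      ext κ
      simp only [SetLike.mem_coe, mem_stabilizerIn_iff, Set.mem_preimage, mem_stabilizer_iff]
    rw [this]
    exact hv.preimage continuous_subtype_val
  haveI := Subgroup.quotient_finite_of_isOpen _ hS
  exact Subgroup.finiteIndex_of_finite_quotient

end Stabilizer

section Eval

variable (ρ : Representation k G V)

/-- Evaluation at `v ∈ V` as a functional on the smooth dual. -/
def evalDual (v : V) : Module.Dual k (SmoothDualSpace ρ) where
  toFun a := (a.val : Module.Dual k V) v
  map_add' a b := by simp
  map_smul' c a := by simp

/-- `evalDual` evaluates. -/
@[simp] theorem evalDual_apply (v : V) (a : SmoothDualSpace ρ) :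
    evalDual ρ v a = (a.val : Module.Dual k V) v := rfl

/-- `evalDual` is `G`-equivariant: `evalDual (ρ g v) = π̃.dual g (evalDual v)`. -/
theorem evalDual_apply_rep (g : G) (v : V) :
    evalDual ρ (ρ g v) = (smoothDualRep ρ).dual g (evalDual ρ v) := by
  ext a
  rw [Representation.dual_apply, Module.Dual.transpose_apply, LinearMap.comp_apply, evalDual_apply,
    evalDual_apply, coe_smoothDualRep_val, Representation.dual_apply, Module.Dual.transpose_apply,
    LinearMap.comp_apply, inv_inv]

/-- The stabiliser of `evalDual v` contains the stabiliser of `v`. -/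
theorem stabilizer_le_stabilizer_evalDual (v : V) :
    stabilizer ρ v ≤ stabilizer (smoothDualRep ρ).dual (evalDual ρ v) := by
  intro g hg
  rw [mem_stabilizer_iff] at hg ⊢
  rw [← evalDual_apply_rep, hg]

/-- For smooth `ρ`, `evalDual v` is a smooth vector of `π̃.dual`. -/
theorem evalDual_mem_smoothVectors (hρ : IsSmooth ρ) (v : V) :
    evalDual ρ v ∈ smoothVectors (smoothDualRep ρ).dual :=
  Subgroup.isOpen_mono (stabilizer_le_stabilizer_evalDual ρ v) (hρ v)

/-- THE CANONICAL MAP `π → π̃̃`, for smooth `ρ`. -/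
def toDoubleDual (hρ : IsSmooth ρ) : V →ₗ[k] SmoothDualSpace (smoothDualRep ρ) where
  toFun v := ⟨⟨evalDual ρ v, evalDual_mem_smoothVectors ρ hρ v⟩⟩
  map_add' v w := by
    apply SmoothDualSpace.ext
    apply Subtype.ext
    ext a
    simp
  map_smul' c v := by
    apply SmoothDualSpace.ext
    apply Subtype.ext
    ext a
    simp

/-- The functional underlying `toDoubleDual v` is `evalDual v`. -/
@[simp] theorem toDoubleDual_val (hρ : IsSmooth ρ) (v : V) :
    ((toDoubleDual ρ hρ v).val : Module.Dual k (SmoothDualSpace ρ)) = evalDual ρ v := rfl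

/-- `toDoubleDual` is `G`-equivariant. -/
theorem toDoubleDual_apply_rep (hρ : IsSmooth ρ) (g : G) (v : V) :
    toDoubleDual ρ hρ (ρ g v) = smoothDualRep (smoothDualRep ρ) g (toDoubleDual ρ hρ v) := by
  apply SmoothDualSpace.ext
  apply Subtype.ext
  rw [toDoubleDual_val, coe_smoothDualRep_val, toDoubleDual_val, evalDual_apply_rep]

end Eval

section Injective

variable (ρ : Representation k G V) [CharZero k]

/-- A non-zero `K`-fixed vector is detected by a `K`-fixed (hence smooth) functional
(`K` open, `ρ` `K`-finite). -/
theorem exists_smoothDualInvariants_apply_ne_zero {K : Subgroup G} (hK : IsOpen (K : Set G))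
    (hKf : KFinite ρ K) {v : V} (hv : v ∈ invariants ρ K) (hne : v ≠ 0) :
    ∃ l ∈ smoothDualInvariants ρ K, (l : Module.Dual k V) v ≠ 0 := by
  have hx : (⟨v, hv⟩ : invariants ρ K) ≠ 0 := fun h => hne (congrArg Subtype.val h)
  obtain ⟨φ, hφ⟩ : ∃ φ : Module.Dual k (invariants ρ K), φ ⟨v, hv⟩ ≠ 0 := by
    by_contra h
    have h' : ∀ φ : Module.Dual k (invariants ρ K), φ ⟨v, hv⟩ = 0 :=
      fun φ => by_contra fun h'' => h ⟨φ, h''⟩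
    exact hx ((Module.forall_dual_apply_eq_zero_iff k _).mp h')
  set l := (dualInvariantsEquiv ρ hKf).symm φ with hl
  refine ⟨l.1, ?_, ?_⟩
  · rw [smoothDualInvariants_eq ρ hK]
    exact l.2
  · have h := congrArg (fun ψ : Module.Dual k (invariants ρ K) => ψ ⟨v, hv⟩)
      ((dualInvariantsEquiv ρ hKf).apply_symm_apply φ)
    simp only [dualInvariantsEquiv_apply] at h
    rw [← hl] at h
    rw [h]
    exact hφ

/-- `π → π̃̃` IS INJECTIVE for smooth `ρ` and a family `𝒦` of open subgroups on which `ρ` is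
`K`-finite and which fixes every vector at some level. -/
theorem toDoubleDual_injective (hρ : IsSmooth ρ) {𝒦 : Set (Subgroup G)}
    (hopen : ∀ K ∈ 𝒦, IsOpen (K : Set G)) (hfin : ∀ K ∈ 𝒦, KFinite ρ K)
    (hcof : ∀ v : V, ∃ K ∈ 𝒦, v ∈ invariants ρ K) : Function.Injective (toDoubleDual ρ hρ) := by
  rw [injective_iff_map_eq_zero]
  intro v hv0
  by_contra hne
  obtain ⟨K, hK, hvK⟩ := hcof v
  obtain ⟨l, hl, hlv⟩ := exists_smoothDualInvariants_apply_ne_zero ρ (hopen K hK) (hfin K hK) hvK hne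
  apply hlv
  have h := congrArg (fun b : SmoothDualSpace (smoothDualRep ρ) =>
    (b.val : Module.Dual k (SmoothDualSpace ρ))
      ⟨⟨l, ((mem_smoothDualInvariants_iff (ρ := ρ)).mp hl).2⟩⟩) hv0
  simpa using h

end Injective

section Surjective

variable (ρ : Representation k G V) [CharZero k]

/-- A `K`-fixed functional `Λ` on `π̃` (with `K` compact, `π̃` smooth) factors through the level
projector `e_K` of `π̃`: `Λ a = Λ (e_K a)`. -/
theorem apply_eq_apply_levelAverage {K : Subgroup G} (hKc : IsCompact (K : Set G))
    {Λ : Module.Dual k (SmoothDualSpace ρ)} (hΛ : Λ ∈ invariants (smoothDualRep ρ).dual K)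
    (a : SmoothDualSpace ρ) : Λ a = Λ (levelAverage (smoothDualRep ρ) K a) := by
  haveI h1 : (stabilizerIn (smoothDualRep ρ).dual K Λ).FiniteIndex := by
    rw [stabilizerIn_eq_top_iff.mpr hΛ]
    infer_instance
  haveI h2 : (stabilizerIn (smoothDualRep ρ) K a).FiniteIndex :=
    finiteIndex_stabilizerIn_of_isOpen_of_isCompact hKc (isSmooth_smoothDualRep ρ a)
  -- the evaluation pairing `Dual × π̃ → k` is `K`-invariant
  let B : Module.Dual k (SmoothDualSpace ρ) →ₗ[k] SmoothDualSpace ρ →ₗ[k] k := LinearMap.id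
  have hB : ∀ κ ∈ K, ∀ (l : Module.Dual k (SmoothDualSpace ρ)) (b : SmoothDualSpace ρ),
      B ((smoothDualRep ρ).dual κ l) (smoothDualRep ρ κ b) = B l b := by
    intro κ _ l b
    simp only [B, LinearMap.id_apply]
    rw [Representation.dual_apply, Module.Dual.transpose_apply, LinearMap.comp_apply,
      ← Module.End.mul_apply, ← map_mul, inv_mul_cancel, map_one, Module.End.one_apply]
  have key := Summit.Ventures.HodgeRepro2.T5LevelIdempotentPairing.levelAverage_left_eq_right
    (smoothDualRep ρ).dual (smoothDualRep ρ) B hB (v := Λ) (w := a)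
  simp only [B, LinearMap.id_apply] at key
  rw [levelAverage_of_mem_invariants hΛ] at key
  exact key

/-- On a `K`-fixed vector `x`, the level projector of `π̃` is invisible: `(e_K a) x = a x`
(`K` compact, `ρ` smooth). -/
theorem levelAverage_val_apply_of_mem_invariants {K : Subgroup G}
    (hKc : IsCompact (K : Set G)) (a : SmoothDualSpace ρ) {x : V} (hx : x ∈ invariants ρ K) :
    ((levelAverage (smoothDualRep ρ) K a).val : Module.Dual k V) x = (a.val : Module.Dual k V) x := by
  -- the functional of `e_K a` is `e_K` (on `ρ.dual`) of the functional of `a` (naturality)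
  have hσ : KFinite (smoothDualRep ρ) K := kFinite_of_isSmooth (isSmooth_smoothDualRep ρ) hKc
  let f : SmoothDualSpace ρ →ₗ[k] Module.Dual k V :=
    (smoothVectors ρ.dual).subtype ∘ₗ (valEquiv (ρ := ρ)).toLinearMap
  have hf : ∀ (g : G) (b : SmoothDualSpace ρ), f (smoothDualRep ρ g b) = ρ.dual g (f b) := by
    intro g b
    rfl
  have hnat := Summit.Ventures.HodgeRepro2.T5LevelIdempotentNaturality.map_levelAverage' hf hσ a
  have hfa : f a = (a.val : Module.Dual k V) := rfl
  have hfe : f (levelAverage (smoothDualRep ρ) K a) =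
      ((levelAverage (smoothDualRep ρ) K a).val : Module.Dual k V) := rfl
  rw [← hfe, hnat, hfa]
  -- `(e_K l) x = l (e_K x) = l x` for `x ∈ V^K`, by the invariant pairing `Dual V × V → k`
  haveI h1 : (stabilizerIn ρ.dual K (a.val : Module.Dual k V)).FiniteIndex :=
    finiteIndex_stabilizerIn_of_isOpen_of_isCompact hKc a.val.2
  haveI h2 : (stabilizerIn ρ K x).FiniteIndex := by
    rw [stabilizerIn_eq_top_iff.mpr hx]
    infer_instance
  let B : Module.Dual k V →ₗ[k] V →ₗ[k] k := LinearMap.id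
  have hB : ∀ κ ∈ K, ∀ (l : Module.Dual k V) (w : V), B (ρ.dual κ l) (ρ κ w) = B l w := by
    intro κ _ l w
    simp only [B, LinearMap.id_apply]
    exact dual_apply_apply ρ κ l w
  have key := Summit.Ventures.HodgeRepro2.T5LevelIdempotentPairing.levelAverage_left_eq_right
    ρ.dual ρ B hB (v := (a.val : Module.Dual k V)) (w := x)
  simp only [B, LinearMap.id_apply] at key
  rw [key, levelAverage_of_mem_invariants hx]

/-- `π → π̃̃` IS SURJECTIVE for smooth admissible `ρ`: `𝒦` a family of compact open subgroups,
cofinal among the open subgroups, `ρ` admissible along `𝒦`. -/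
theorem toDoubleDual_surjective (hρ : IsSmooth ρ) {𝒦 : Set (Subgroup G)}
    (hopen : ∀ K ∈ 𝒦, IsOpen (K : Set G)) (hcpt : ∀ K ∈ 𝒦, IsCompact (K : Set G))
    (hbasis : ∀ U : Subgroup G, IsOpen (U : Set G) → ∃ K ∈ 𝒦, K ≤ U)
    (hadm : IsAdmissible ρ 𝒦) : Function.Surjective (toDoubleDual ρ hρ) := by
  intro Λ
  -- `Λ.val` is a smooth functional on `π̃`: fixed by some `K ∈ 𝒦`
  obtain ⟨K, hK, hKle⟩ := hbasis _ Λ.val.2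
  have hΛ : (Λ.val : Module.Dual k (SmoothDualSpace ρ)) ∈ invariants (smoothDualRep ρ).dual K := by
    rw [mem_invariants_iff]
    intro g hg
    exact mem_stabilizer_iff.mp (hKle hg)
  have hKf : KFinite ρ K := kFinite_of_isSmooth hρ (hcpt K hK)
  haveI : FiniteDimensional k (invariants ρ K) := hadm K hK
  -- the restriction of `Λ` to `(π̃)^K ≅ (π^K)^*` is evaluation at some `x ∈ π^K`
  let e := invariantsSmoothDualRepEquiv ρ (hopen K hK) hKf
  let ψ : Module.Dual k (Module.Dual k (invariants ρ K)) :=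
    ((Λ.val : Module.Dual k (SmoothDualSpace ρ)) ∘ₗ (invariants (smoothDualRep ρ) K).subtype) ∘ₗ
      e.symm.toLinearMap
  obtain ⟨x, hx⟩ := (Module.bijective_dual_eval k (invariants ρ K)).2 ψ
  refine ⟨x, ?_⟩
  apply SmoothDualSpace.ext
  apply Subtype.ext
  ext a
  rw [toDoubleDual_val, evalDual_apply]
  -- `Λ a = Λ (e_K a)`, and `e_K a ∈ (π̃)^K`
  rw [apply_eq_apply_levelAverage ρ (hcpt K hK) hΛ a]
  haveI : (stabilizerIn (smoothDualRep ρ) K a).FiniteIndex :=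
    finiteIndex_stabilizerIn_of_isOpen_of_isCompact (hcpt K hK) (isSmooth_smoothDualRep ρ a)
  set b : invariants (smoothDualRep ρ) K := ⟨levelAverage (smoothDualRep ρ) K a,
    levelAverage_mem_invariants⟩ with hb
  have h1 : (Λ.val : Module.Dual k (SmoothDualSpace ρ)) b = ψ (e b) := by
    simp only [ψ, LinearMap.comp_apply, LinearEquiv.coe_toLinearMap, LinearEquiv.symm_apply_apply,
      Submodule.coe_subtype]
  have h2 : ψ (e b) = (e b) x := by
    rw [← hx, Module.Dual.eval_apply]
  have h3 : (e b) x = ((b.1.val : Module.Dual k V)) x :=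
    invariantsSmoothDualRepEquiv_apply ρ (hopen K hK) hKf b x
  symm
  change (Λ.val : Module.Dual k (SmoothDualSpace ρ)) b = _
  rw [h1, h2, h3]
  exact levelAverage_val_apply_of_mem_invariants ρ (hcpt K hK) a x.2

/-- `π ≅ π̃̃`: the canonical map is a linear isomorphism for smooth admissible `ρ`
(`𝒦` compact open, cofinal among the open subgroups, `ρ` admissible along `𝒦`, characteristic `0`). -/
def doubleDualEquiv (hρ : IsSmooth ρ) {𝒦 : Set (Subgroup G)}
    (hopen : ∀ K ∈ 𝒦, IsOpen (K : Set G)) (hcpt : ∀ K ∈ 𝒦, IsCompact (K : Set G))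
    (hbasis : ∀ U : Subgroup G, IsOpen (U : Set G) → ∃ K ∈ 𝒦, K ≤ U)
    (hadm : IsAdmissible ρ 𝒦) : V ≃ₗ[k] SmoothDualSpace (smoothDualRep ρ) :=
  LinearEquiv.ofBijective (toDoubleDual ρ hρ)
    ⟨toDoubleDual_injective ρ hρ hopen (fun K hK => kFinite_of_isSmooth hρ (hcpt K hK))
      (fun v => by
        obtain ⟨K, hK, hKle⟩ := hbasis _ (hρ v)
        exact ⟨K, hK, by
          rw [mem_invariants_iff]
          intro g hg
          exact mem_stabilizer_iff.mp (hKle hg)⟩),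
      toDoubleDual_surjective ρ hρ hopen hcpt hbasis hadm⟩

/-- `doubleDualEquiv` is the canonical map. -/
@[simp] theorem doubleDualEquiv_apply (hρ : IsSmooth ρ) {𝒦 : Set (Subgroup G)}
    (hopen : ∀ K ∈ 𝒦, IsOpen (K : Set G)) (hcpt : ∀ K ∈ 𝒦, IsCompact (K : Set G))
    (hbasis : ∀ U : Subgroup G, IsOpen (U : Set G) → ∃ K ∈ 𝒦, K ≤ U)
    (hadm : IsAdmissible ρ 𝒦) (v : V) :
    doubleDualEquiv ρ hρ hopen hcpt hbasis hadm v = toDoubleDual ρ hρ v := rfl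

/-- `doubleDualEquiv` is `G`-equivariant: `π ≅ π̃̃` as representations. -/
theorem doubleDualEquiv_apply_rep (hρ : IsSmooth ρ) {𝒦 : Set (Subgroup G)}
    (hopen : ∀ K ∈ 𝒦, IsOpen (K : Set G)) (hcpt : ∀ K ∈ 𝒦, IsCompact (K : Set G))
    (hbasis : ∀ U : Subgroup G, IsOpen (U : Set G) → ∃ K ∈ 𝒦, K ≤ U)
    (hadm : IsAdmissible ρ 𝒦) (g : G) (v : V) :
    doubleDualEquiv ρ hρ hopen hcpt hbasis hadm (ρ g v) =
      smoothDualRep (smoothDualRep ρ) g (doubleDualEquiv ρ hρ hopen hcpt hbasis hadm v) := by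
  rw [doubleDualEquiv_apply, doubleDualEquiv_apply, toDoubleDual_apply_rep]

end Surjective

end

end Summit.Ventures.HodgeRepro2.T5SmoothDoubleDual
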